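import Summits.HubbardSuperconductivity.HubbardSuperconductivity.Theorems.AnisotropyChordTransferFibre3FinXBCover

/-!
# Route `AnisotropyChord` / H0 rotor rung: FIN exact-block row-`N₁` certificate at `L = 9` — cell facts, part `e`

Kernel facts `xbCellAny 9 (49/50) la lb c = true` (`decide +kernel`, zero data) for 5 λ-cells of the per-`L` cover
(`…FinXBCover.xbCheck`; cell design: p3 g5 scratch `xb_design.py`, float mirror `xb_mirror.py`); assembled in `…FinXBNine`.
Prover seat `hubbard-h0-rotor-p3` g5; helper for piece A = stmt-HubbardSuperconductivity-23918 of rung 19089 (`--supports`, helper class).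
WHAT THIS IS NOT: nothing here proves superconductivity in the Hubbard model (rotor TARGET as worded stays FALSE, g15 verdict); kernel facts for the FIN certificate of ONE hypothesis (row `N₁`) of ONE conditional reduction.  Tree imports only; no sorry, no new axioms.
-/

namespace Summit.HubbardSuperconductivity.HubbardSuperconductivity.Theorems.AnisotropyChord.Transfer.Fibre3

namespace FinXB

set_option maxHeartbeats 4000000 in
/-- kernel fact: cell 92 at `L = 9` (certified, c = (2/5 : ℚ)). [folklore] -/
theorem xb9_92 : xbCellAny 9 (49/50 : ℚ) 27050761254407397 28673806929671841 (2/5 : ℚ) = true := by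
  decide +kernel

set_option maxHeartbeats 4000000 in
/-- kernel fact: cell 93 at `L = 9` (certified, c = (2/5 : ℚ)). [folklore] -/
theorem xb9_93 : xbCellAny 9 (49/50 : ℚ) 28673806929671841 30394235345452153 (2/5 : ℚ) = true := by
  decide +kernel

set_option maxHeartbeats 4000000 in
/-- kernel fact: cell 94 at `L = 9` (certified, c = (7/20 : ℚ)). [folklore] -/
theorem xb9_94 : xbCellAny 9 (49/50 : ℚ) 30394235345452153 32217889466179285 (7/20 : ℚ) = true := by
  decide +kernel

set_option maxHeartbeats 4000000 in
/-- kernel fact: cell 95 at `L = 9` (certified, c = (7/20 : ℚ)). [folklore] -/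
theorem xb9_95 : xbCellAny 9 (49/50 : ℚ) 32217889466179285 34150962834150045 (7/20 : ℚ) = true := by
  decide +kernel

set_option maxHeartbeats 4000000 in
/-- kernel fact: cell 96 at `L = 9` (certified, c = (7/20 : ℚ)). [folklore] -/
theorem xb9_96 : xbCellAny 9 (49/50 : ℚ) 34150962834150045 36200020604199049 (7/20 : ℚ) = true := by
  decide +kernel

end FinXB

end Summit.HubbardSuperconductivity.HubbardSuperconductivity.Theorems.AnisotropyChord.Transfer.Fibre3
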